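import Literature.Analysis.ODE.TorusFlowJacobian
import Literature.Analysis.FunctionSpaces.TorusAnalyticComposition
import HarnessLib

/-!
# The inverse flow on the torus: `(∇X)∘X⁻¹ = adj(∇X⁻¹)`, and the transport equation of `X⁻¹ − id`

Analysis/ODE proof file (theorems only; no definitions, no named facts). Setting of Armstrong–Vicol,
App. A §7.3 (Prop. 7.10) in the tree's torus vocabulary: `f : ℝ × T^d → ℝ^d` jointly smooth, its flow
`X(t) = id + proj ∘ D(t)` (`D` jointly smooth, `D(0) = 0`, `∂ₜD = f ∘ X`), and a two-sided inverse
`X⁻¹(t) = id + proj ∘ Dinv(t)` with a jointly smooth inverse displacement `Dinv`. We prove: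

* §1 a continuous map with values in the lattice `ℤ^d ⊂ ℝ^d` (i.e. killed by `proj`) has zero
  derivative (`hasFDerivAt_zero_of_proj_eq`), the tool that turns the torus identities `X ∘ X⁻¹ = id`,
  `X⁻¹ ∘ X = id` into identities between ℝ^d-valued displacements up to lattice constants;
* §2 **`(1 + ∇D)(t, X⁻¹(t,y)) · (1 + ∇Dinv(t,y)) = 1`** (`flowGrad_comp_inv_mul`), hence, for
  divergence-free `f` (where `det(1 + ∇D) = 1`, `TorusFlow.det_flowGrad_eq_one`),
  **`det (1 + ∇Dinv) = 1`** (`det_flowGradInv_eq_one`) and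
  **`(∇X)∘X⁻¹ = (1 + ∇Dinv)⁻¹ = adj(1 + ∇Dinv)`** (`flowGrad_comp_inv_eq_adjugate`) — the identity
  "`∇X(t, X⁻¹(t,·)) = cof(∇X⁻¹)ᵀ/det`, `det = 1`" of the proof of Prop. 7.10;
* §3 **the transport equation of the inverse displacement**: `∂ₜ Dinv + (f·∇) Dinv = −f`
  (`hasDerivAt_dispInv`; "`Y := X⁻¹ − id` solves `(∂ₜ + f·∇)Y = −f`", proof of Prop. 7.10), and
  `∇ Dinv(0,·) = 0`;
* §4 **Cor. 7.8 for the inverse displacement**: with `Y = Dinv − Dinv(0)` the DISCHARGED Cor. 7.8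
  (`Torus.ArmstrongVicol2025_transportShift_grad_holds`, `g = −f`, `R_g = R_f`, `C_g = C_f`) gives
  `⟦∂ⱼ Dinvᵢ(t)⟧_{n, R_f(1+4|t|dC_fR_f)²} ≤ 4d` for `n + 1 ≤ N`, `|t| ≤ 1/(4dC_fR_f)`
  (`dnorm_partialDeriv_dispInv_le`).

These are steps (a)–(d) of the discharge of `Torus.ArmstrongVicol2025_flowGrad_comp_inv` (Prop. 7.10,
second display) under the regularity of `X⁻¹` that the cell's Lagrangian carriers carry; the
remaining step is the seminorm algebra of the adjugate (Lemma 7.1 with constant 4, `TorusAnalyticProduct`).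

## References

* S. Armstrong, V. Vicol, *Anomalous diffusion by fractal homogenization*, Ann. PDE 11 (2025),
  arXiv:2305.05048, App. A §7.3, Prop. 7.10 and its proof (p. 73). [`ArmstrongVicol2025`]
* A. J. Majda, A. L. Bertozzi, *Vorticity and Incompressible Flow* (CUP 2002), §1.3 (particle
  trajectory map, its inverse, `J ≡ 1`). [`MajdaBertozziCUP2002`]
-/

noncomputable section

open Set Filter Topology Function Matrix
open scoped ContDiff

namespace Literature.Analysis.ODE

namespace TorusFlow

open Literature.Analysis.FunctionSpaces Literature.Analysis.FunctionSpaces.Torus Literature.Analysis.Calculus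

variable {d : Type*} [Fintype d] [DecidableEq d]

/-! ## §1 Lattice-valued continuous maps have zero derivative -/

/-- A nonzero lattice vector has norm at least `1`. [folklore] -/
private theorem latticeVec_eq_zero_of_norm_lt_one {k : d → ℤ} (hk : ‖latticeVec k‖ < 1) : k = 0 := by
  by_contra hne
  obtain ⟨i, hi⟩ : ∃ i, k i ≠ 0 := by
    by_contra h
    exact hne (funext fun i => not_not.1 (not_exists.1 h i))
  have h1 : (1 : ℝ) ≤ |(k i : ℝ)| := by
    have : (1 : ℤ) ≤ |k i| := Int.one_le_abs hi
    exact_mod_cast this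
  have h2 : |(k i : ℝ)| ≤ ‖latticeVec k‖ := by
    have := PiLp.norm_apply_le (latticeVec k) i
    rwa [Real.norm_eq_abs, latticeVec_apply] at this
  linarith

/-- **A continuous `ℝ^d`-valued map whose image in `T^d` is constant is locally constant, hence has
zero derivative**: if `proj (Ψ v) = proj (Ψ v₀)`-type constancy holds (`Ψ − Ψ(v)` is lattice valued),
then `DΨ = 0` everywhere. [folklore] -/
private theorem hasFDerivAt_zero_of_proj_eq {E' : Type*} [NormedAddCommGroup E'] [NormedSpace ℝ E']
    {Ψ : E' → EuclideanSpace ℝ d} (hΨ : Continuous Ψ) {c : UnitAddTorus d} (hc : ∀ v, proj (Ψ v) = c)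
    (v : E') : HasFDerivAt Ψ (0 : E' →L[ℝ] EuclideanSpace ℝ d) v := by
  have hconst : ∀ᶠ w in 𝓝 v, Ψ w = Ψ v := by
    have h1 : ∀ᶠ w in 𝓝 v, ‖Ψ w - Ψ v‖ < 1 := by
      have := (hΨ.continuousAt (x := v)).eventually (Metric.ball_mem_nhds (Ψ v) one_pos)
      filter_upwards [this] with w hw
      rwa [dist_eq_norm] at hw
    filter_upwards [h1] with w hw
    obtain ⟨k, hk⟩ := (proj_eq_proj_iff_holds (Ψ v) (Ψ w)).1 (by rw [hc, hc])
    have hk' : Ψ w - Ψ v = latticeVec k := by rw [hk]; abel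
    rw [hk'] at hw
    have := latticeVec_eq_zero_of_norm_lt_one hw
    rw [this, latticeVec_zero] at hk'
    exact sub_eq_zero.1 hk'
  exact (hasFDerivAt_const (Ψ v) v).congr_of_eventuallyEq (hconst.mono fun w hw => hw)

/-- One-variable form: a continuous lattice-valued curve has zero derivative. [folklore] -/
private theorem hasDerivAt_zero_of_proj_eq {θ : ℝ → EuclideanSpace ℝ d} (hθ : Continuous θ) {c : UnitAddTorus d}
    (hc : ∀ s, proj (θ s) = c) (t : ℝ) : HasDerivAt θ 0 t := by
  have h := (hasFDerivAt_zero_of_proj_eq hθ hc t).hasDerivAt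
  simpa using h

/-- Torus form: a continuous `T^d → ℝ^d` map killed by `proj` (up to a constant) has all partial
derivatives zero. [folklore] -/
private theorem partialDeriv_eq_zero_of_proj_eq {Φ : UnitAddTorus d → EuclideanSpace ℝ d} (hΦ : IsContDiff 1 Φ)
    {c : UnitAddTorus d} (hc : ∀ y, proj (Φ y) = c) (j : d) (y : UnitAddTorus d) :
    partialDeriv j Φ y = 0 := by
  obtain ⟨v, rfl⟩ := proj_surjective y
  have hcont : Continuous (lift Φ) := by
    have h : ContDiff ℝ 1 (lift Φ) := hΦ
    exact h.continuous
  have h0 : _root_.fderiv ℝ (lift Φ) v = 0 :=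
    (hasFDerivAt_zero_of_proj_eq hcont (fun w => hc (proj w)) v).fderiv
  rw [partialDeriv_eq_fderiv_apply hΦ, ← fderiv_lift, h0]
  rfl

/-! ## §2 `(∇X)∘X⁻¹ · ∇X⁻¹ = 1`, `det ∇X⁻¹ = 1`, `(∇X)∘X⁻¹ = adj(∇X⁻¹)` -/

variable {f D Dinv : ℝ → UnitAddTorus d → EuclideanSpace ℝ d}

omit [Fintype d] [DecidableEq d] in
/-- From `X(X⁻¹ y) = y`: the displacement sum `Dinv(t,y) + D(t, X⁻¹(t,y))` is killed by `proj`. [folklore] -/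
private theorem proj_dispSum_eq_zero
    (hinv₂ : ∀ t y, (y + proj (Dinv t y)) + proj (D t (y + proj (Dinv t y))) = y) (t : ℝ) (y : UnitAddTorus d) :
    proj (Dinv t y + D t (y + proj (Dinv t y))) = 0 := by
  have h := hinv₂ t y
  rw [add_assoc] at h
  have h2 : proj (Dinv t y) + proj (D t (y + proj (Dinv t y))) = 0 := by
    have := congrArg (fun z => -y + z) h
    simpa using this
  rw [proj_add, h2]

/-- **`(1 + ∇D)(t, X⁻¹(t,y)) · (1 + ∇Dinv(t,y)) = 1`**: differentiate `X(t, X⁻¹(t,y)) = y`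
(the displacement sum `Dinv + D ∘ X⁻¹` is lattice valued, hence has zero derivative; chain rule
`TorusFlow.partialDeriv_comp_add_proj_apply`). [cite: ArmstrongVicol2025, App. A Prop. 7.10 (proof, p. 73)] -/
theorem flowGrad_comp_inv_mul (hD : IsSmoothSpaceTimeOn univ D) (hDinv : IsSmoothSpaceTimeOn univ Dinv)
    (hinv₂ : ∀ t y, (y + proj (Dinv t y)) + proj (D t (y + proj (Dinv t y))) = y) (t : ℝ) (y : UnitAddTorus d) :
    (Matrix.of fun i k => (1 : Matrix d d ℝ) i k + partialDeriv k (fun z => D t z i) (y + proj (Dinv t y))) *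
      (Matrix.of fun k j => (1 : Matrix d d ℝ) k j + partialDeriv j (fun z => Dinv t z k) y) = 1 := by
  have hD1 : IsContDiff 1 (D t) := (hD.isSmooth_slice (mem_univ t)).isContDiff (by simp)
  have hDinv1 : IsContDiff 1 (Dinv t) := (hDinv.isSmooth_slice (mem_univ t)).isContDiff (by simp)
  have hcomp1 : IsContDiff 1 (fun z => D t (z + proj (Dinv t z))) := isContDiff_comp_add_proj hD1 hDinv1
  -- the lattice-valued displacement sum has zero partial derivatives
  have hΦ1 : IsContDiff 1 (fun z => Dinv t z + D t (z + proj (Dinv t z))) := hDinv1.add hcomp1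
  have hzero : ∀ i j, partialDeriv j (fun z => Dinv t z i) y +
      partialDeriv j (fun z => D t (z + proj (Dinv t z)) i) y = 0 := by
    intro i j
    have h := partialDeriv_eq_zero_of_proj_eq hΦ1 (c := 0) (proj_dispSum_eq_zero hinv₂ t) j y
    have h' := congrArg (fun v : EuclideanSpace ℝ d => v i) h
    simp only at h'
    rw [← partialDeriv_apply_coord hΦ1, PiLp.zero_apply] at h'
    rw [← h']
    have e : (fun z => (Dinv t z + D t (z + proj (Dinv t z))) i) =
        (fun z => Dinv t z i) + fun z => D t (z + proj (Dinv t z)) i := by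
      funext z; rfl
    rw [e, partialDeriv_add ((hDinv.isSmooth_slice (mem_univ t)).apply i |>.isContDiff (by simp))
      (((isSmooth_comp_add_proj (hD.isSmooth_slice (mem_univ t)) (hDinv.isSmooth_slice (mem_univ t))).apply i).isContDiff
        (by simp)), Pi.add_apply]
  -- the entry computation
  ext i j
  rw [Matrix.mul_apply, Matrix.one_apply]
  have hsplit : ∑ k, (Matrix.of (fun i k => (1 : Matrix d d ℝ) i k +
      partialDeriv k (fun z => D t z i) (y + proj (Dinv t y)))) i k *
      (Matrix.of (fun k j => (1 : Matrix d d ℝ) k j + partialDeriv j (fun z => Dinv t z k) y)) k j =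
      ((1 : Matrix d d ℝ) i j + partialDeriv j (fun z => Dinv t z i) y) +
        ∑ k, partialDeriv k (fun z => D t z i) (y + proj (Dinv t y)) *
          ((1 : Matrix d d ℝ) k j + partialDeriv j (fun z => Dinv t z k) y) := by
    simp only [Matrix.of_apply, add_mul, Finset.sum_add_distrib]
    congr 1
    simp only [Matrix.one_apply, ite_mul, one_mul, zero_mul, Finset.sum_ite_eq, Finset.mem_univ, if_true]
  rw [hsplit, ← partialDeriv_comp_add_proj_apply hD1 hDinv1 i j y, add_assoc, hzero i j, add_zero,
    Matrix.one_apply]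

/-- **`det (1 + ∇Dinv(t,y)) = 1`** for the inverse of the flow of a divergence-free field
(`det(1 + ∇D) = 1` at `X⁻¹(t,y)`, `TorusFlow.det_flowGrad_eq_one`, and the product identity).
[cite: ArmstrongVicol2025, App. A Prop. 7.10 (proof, p. 73)] -/
theorem det_flowGradInv_eq_one (hf : IsSmoothSpaceTimeOn univ f) (hD : IsSmoothSpaceTimeOn univ D)
    (hDinv : IsSmoothSpaceTimeOn univ Dinv) (hD0 : ∀ x, D 0 x = 0)
    (hODE : ∀ t x, HasDerivAt (fun s => D s x) (f t (x + proj (D t x))) t) (hdiv : ∀ t, IsDivFree (f t))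
    (hinv₂ : ∀ t y, (y + proj (Dinv t y)) + proj (D t (y + proj (Dinv t y))) = y) (t : ℝ) (y : UnitAddTorus d) :
    (Matrix.of fun k j => (1 : Matrix d d ℝ) k j + partialDeriv j (fun z => Dinv t z k) y).det = 1 := by
  have h := congrArg Matrix.det (flowGrad_comp_inv_mul hD hDinv hinv₂ t y)
  rw [Matrix.det_mul, det_flowGrad_eq_one hf hD hD0 hODE hdiv t (y + proj (Dinv t y)), one_mul,
    Matrix.det_one] at h
  exact h

/-- **`(∇X)(t, X⁻¹(t,y)) = adj(1 + ∇Dinv(t,y))`** — "`∇X ∘ X⁻¹ = (∇X⁻¹)⁻¹ = cofᵀ(∇X⁻¹)/det(∇X⁻¹)`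
with `det = 1`" (Armstrong–Vicol, proof of Prop. 7.10). [cite: ArmstrongVicol2025, App. A Prop. 7.10 (proof, p. 73)] -/
theorem flowGrad_comp_inv_eq_adjugate (hf : IsSmoothSpaceTimeOn univ f) (hD : IsSmoothSpaceTimeOn univ D)
    (hDinv : IsSmoothSpaceTimeOn univ Dinv) (hD0 : ∀ x, D 0 x = 0)
    (hODE : ∀ t x, HasDerivAt (fun s => D s x) (f t (x + proj (D t x))) t) (hdiv : ∀ t, IsDivFree (f t))
    (hinv₂ : ∀ t y, (y + proj (Dinv t y)) + proj (D t (y + proj (Dinv t y))) = y) (t : ℝ) (y : UnitAddTorus d) :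
    (Matrix.of fun i k => (1 : Matrix d d ℝ) i k + partialDeriv k (fun z => D t z i) (y + proj (Dinv t y))) =
      (Matrix.of fun k j => (1 : Matrix d d ℝ) k j + partialDeriv j (fun z => Dinv t z k) y).adjugate := by
  have hmul := flowGrad_comp_inv_mul hD hDinv hinv₂ t y
  have hdet := det_flowGradInv_eq_one hf hD hDinv hD0 hODE hdiv hinv₂ t y
  rw [← Matrix.inv_eq_left_inv hmul, Matrix.inv_def, hdet, Ring.inverse_one, one_smul]

/-! ## §3 The transport equation of the inverse displacement -/

omit [Fintype d] [DecidableEq d] in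
/-- From `X⁻¹(X x) = x`: the displacement sum `D(s,x) + Dinv(s, X(s,x))` is killed by `proj`. [folklore] -/
private theorem proj_dispSum'_eq_zero
    (hinv₁ : ∀ t x, (x + proj (D t x)) + proj (Dinv t (x + proj (D t x))) = x) (s : ℝ) (x : UnitAddTorus d) :
    proj (D s x + Dinv s (x + proj (D s x))) = 0 := by
  have h := hinv₁ s x
  rw [add_assoc] at h
  have h2 : proj (D s x) + proj (Dinv s (x + proj (D s x))) = 0 := by
    have := congrArg (fun z => -x + z) h
    simpa using this
  rw [proj_add, h2]

omit [DecidableEq d] in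
/-- The space–time derivative of a jointly smooth field splits into the time slice derivative and the
space derivative: along a curve `s ↦ (s, w(s))` with `w'(t) = v`,
`d/ds Dinv(s, proj w(s))|_t = ∂ₜDinv(t, proj w(t)) + D(Dinv t)(proj w(t)) v`. [folklore] -/
private theorem hasDerivAt_stLift_comp (hDinv : IsSmoothSpaceTimeOn univ Dinv) {w : ℝ → EuclideanSpace ℝ d}
    {v : EuclideanSpace ℝ d} {t : ℝ} (hw : HasDerivAt w v t) :
    HasDerivAt (fun s => Dinv s (proj (w s)))
      (timeDeriv Dinv t (proj (w t)) + Torus.fderiv (Dinv t) (proj (w t)) v) t := by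
  have hcd : ContDiff ℝ ∞ (stLift Dinv) := by
    have h := hDinv
    unfold IsSmoothSpaceTimeOn at h
    rwa [univ_prod_univ, contDiffOn_univ] at h
  have hdiff : ∀ p, HasFDerivAt (stLift Dinv) (_root_.fderiv ℝ (stLift Dinv) p) p := fun p =>
    ((hcd.differentiable (by simp)) p).hasFDerivAt
  set L := _root_.fderiv ℝ (stLift Dinv) (t, w t) with hL
  -- the curve and the composition
  have hγ : HasDerivAt (fun s => (s, w s)) ((1 : ℝ), v) t := (hasDerivAt_id t).prodMk hw
  have hcomp : HasDerivAt (fun s => stLift Dinv (s, w s)) (L ((1 : ℝ), v)) t := by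
    have h := (hdiff (t, w t)).comp_hasDerivAt t hγ
    exact h
  -- identify `L (1, 0)` with the time derivative and `L (0, v)` with the space derivative
  have h10 : HasDerivAt (fun s => Dinv s (proj (w t))) (L ((1 : ℝ), (0 : EuclideanSpace ℝ d))) t := by
    have hc : HasDerivAt (fun s : ℝ => (s, w t)) ((1 : ℝ), (0 : EuclideanSpace ℝ d)) t :=
      (hasDerivAt_id t).prodMk (hasDerivAt_const t (w t))
    exact (hdiff (t, w t)).comp_hasDerivAt t hc
  have htime : timeDeriv Dinv t (proj (w t)) = L ((1 : ℝ), (0 : EuclideanSpace ℝ d)) := h10.deriv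
  have hspace : Torus.fderiv (Dinv t) (proj (w t)) v = L ((0 : ℝ), v) := by
    have hc : HasFDerivAt (lift (Dinv t)) (L.comp (ContinuousLinearMap.inr ℝ ℝ (EuclideanSpace ℝ d))) (w t) :=
      (hdiff (t, w t)).comp (w t) (hasFDerivAt_prodMk_right t (w t))
    rw [← fderiv_lift, hc.fderiv, ContinuousLinearMap.comp_apply, ContinuousLinearMap.inr_apply]
  have hsplit : L ((1 : ℝ), v) = L ((1 : ℝ), (0 : EuclideanSpace ℝ d)) + L ((0 : ℝ), v) := by
    rw [← map_add, Prod.mk_add_mk, add_zero, zero_add]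
  rw [htime, hspace, ← hsplit]
  exact hcomp

omit [DecidableEq d] in
/-- A displacement with a pointwise time derivative is continuous in time at fixed `x`. [folklore] -/
private theorem continuous_disp_slice
    (hODE : ∀ t x, HasDerivAt (fun s => D s x) (f t (x + proj (D t x))) t) (x : UnitAddTorus d) :
    Continuous fun s => D s x :=
  continuous_iff_continuousAt.2 fun s => (hODE s x).continuousAt

/-- **The transport equation of the inverse displacement** (Armstrong–Vicol, proof of Prop. 7.10:
"`Y := X⁻¹ − id` solves `(∂ₜ + f·∇)Y = −f`"): differentiating `X⁻¹(t, X(t,x)) = x` in `t` along the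
flow gives `∂ₜ Dinv(t,y) = −f(t,y) − (f(t,y)·∇) Dinv(t,·)(y)` at every `y = X(t,x)`, i.e. everywhere.
[cite: ArmstrongVicol2025, App. A Prop. 7.10 (proof, p. 73)] -/
theorem hasDerivAt_dispInv (hDinv : IsSmoothSpaceTimeOn univ Dinv)
    (hODE : ∀ t x, HasDerivAt (fun s => D s x) (f t (x + proj (D t x))) t)
    (hinv₁ : ∀ t x, (x + proj (D t x)) + proj (Dinv t (x + proj (D t x))) = x)
    (hinv₂ : ∀ t y, (y + proj (Dinv t y)) + proj (D t (y + proj (Dinv t y))) = y) (t : ℝ) (y : UnitAddTorus d) :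
    HasDerivAt (fun s => Dinv s y) (-f t y - convect (f t) (Dinv t) y) t := by
  -- the base point `x = X⁻¹(t,y)`, so that `X(t,x) = y`
  set x : UnitAddTorus d := y + proj (Dinv t y) with hx
  have hXx : x + proj (D t x) = y := hinv₂ t y
  obtain ⟨xv, hxv⟩ := proj_surjective x
  -- the lattice-valued sum `Θ(s) = D(s,x) + Dinv(s, X(s,x))` has zero derivative
  have hw : HasDerivAt (fun s => xv + D s x) (f t (x + proj (D t x))) t := by
    simpa using (hODE t x).const_add xv
  have hprojw : ∀ s, proj (xv + D s x) = x + proj (D s x) := fun s => by rw [proj_add, hxv]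
  have hΘ' : HasDerivAt (fun s => D s x + Dinv s (proj (xv + D s x)))
      (f t (x + proj (D t x)) + (timeDeriv Dinv t (proj (xv + D t x)) +
        Torus.fderiv (Dinv t) (proj (xv + D t x)) (f t (x + proj (D t x))))) t :=
    (hODE t x).add (hasDerivAt_stLift_comp hDinv hw)
  have hΘc : Continuous (fun s => D s x + Dinv s (proj (xv + D s x))) := by
    have h1 : Continuous fun s => D s x := continuous_disp_slice hODE x
    have hcd : ContDiff ℝ ∞ (stLift Dinv) := by
      have h := hDinv
      unfold IsSmoothSpaceTimeOn at h
      rwa [univ_prod_univ, contDiffOn_univ] at h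
    have h2 : Continuous fun s => stLift Dinv (s, xv + D s x) :=
      hcd.continuous.comp (continuous_id.prodMk (continuous_const.add h1))
    exact h1.add h2
  have hΘ0 : HasDerivAt (fun s => D s x + Dinv s (proj (xv + D s x))) 0 t := by
    refine hasDerivAt_zero_of_proj_eq hΘc (c := 0) (fun s => ?_) t
    rw [hprojw]
    exact proj_dispSum'_eq_zero hinv₁ s x
  have heq := hΘ'.unique hΘ0
  rw [hprojw, hXx] at heq
  -- the slice derivative exists and equals `timeDeriv`
  have hslice : HasDerivAt (fun s => Dinv s y) (timeDeriv Dinv t y) t := by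
    have h := hasDerivAt_stLift_comp hDinv (w := fun _ => xv + D t x) (v := 0) (t := t) (hasDerivAt_const t _)
    simp only [map_zero, add_zero] at h
    rw [hprojw, hXx] at h
    exact h
  have hval : timeDeriv Dinv t y = -f t y - convect (f t) (Dinv t) y := by
    have e : f t y + (timeDeriv Dinv t y + Torus.fderiv (Dinv t) y (f t y)) = 0 := heq
    have e1 : timeDeriv Dinv t y + Torus.fderiv (Dinv t) y (f t y) = -f t y := eq_neg_of_add_eq_zero_right e
    exact eq_sub_of_add_eq e1
  rw [← hval]
  exact hslice

/-! ## §4 Cor. 7.8 for the inverse displacement -/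

omit [DecidableEq d] in
/-- `D(v − w) = Dv − Dw` for `C¹` fields on the torus. [folklore] -/
private theorem fderiv_sub' {v w : UnitAddTorus d → EuclideanSpace ℝ d} (hv : IsContDiff 1 v) (hw : IsContDiff 1 w)
    (x : UnitAddTorus d) :
    Torus.fderiv (fun y => v y - w y) x = Torus.fderiv v x - Torus.fderiv w x := by
  unfold Torus.fderiv
  rw [show liftAt (fun y => v y - w y) x = liftAt v x - liftAt w x from rfl]
  exact _root_.fderiv_sub ((hv.liftAt x).differentiable one_ne_zero).differentiableAt
    ((hw.liftAt x).differentiable one_ne_zero).differentiableAt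

omit [Fintype d] [DecidableEq d] in
/-- From `X⁻¹(0) ∘ X(0) = id` and `D(0) = 0`: the initial inverse displacement `Dinv(0,·)` is lattice
valued. [folklore] -/
private theorem proj_dispInv_zero (hD0 : ∀ x, D 0 x = 0)
    (hinv₁ : ∀ t x, (x + proj (D t x)) + proj (Dinv t (x + proj (D t x))) = x) (y : UnitAddTorus d) :
    proj (Dinv 0 y) = 0 := by
  have h := hinv₁ 0 y
  rw [hD0 y, proj_zero, add_zero] at h
  have := congrArg (fun z => -y + z) h
  simpa using this

/-- The initial inverse displacement has zero space derivative: `D(Dinv(0,·)) = 0` (it is a continuous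
lattice-valued map). [cite: ArmstrongVicol2025, App. A Prop. 7.10 (proof, p. 73)] -/
theorem fderiv_dispInv_zero (hDinv : IsSmoothSpaceTimeOn univ Dinv) (hD0 : ∀ x, D 0 x = 0)
    (hinv₁ : ∀ t x, (x + proj (D t x)) + proj (Dinv t (x + proj (D t x))) = x) (y : UnitAddTorus d) :
    Torus.fderiv (Dinv 0) y = 0 := by
  obtain ⟨v, rfl⟩ := proj_surjective y
  have h1 : IsContDiff 1 (Dinv 0) := (hDinv.isSmooth_slice (mem_univ 0)).isContDiff (by simp)
  have hcont : Continuous (lift (Dinv 0)) := by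
    have h : ContDiff ℝ 1 (lift (Dinv 0)) := h1
    exact h.continuous
  rw [← fderiv_lift]
  exact (hasFDerivAt_zero_of_proj_eq hcont (fun w => proj_dispInv_zero hD0 hinv₁ (proj w)) v).fderiv

/-- **Cor. 7.8 for the inverse displacement** (Armstrong–Vicol, proof of Prop. 7.10: "`Y = X⁻¹ − id`
solves the transport equation with `g = −f`, so Cor. 7.8 applies with `R_g = R_f`, `C_g = C_f`"):
if `max_{1≤n≤N} sup_t ⟦f(t)⟧_{n,R_f} ≤ C_f`, then for `n + 1 ≤ N` and `|t| ≤ 1/(4dC_fR_f)`,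
`⟦∂ⱼ Dinvᵢ(t)⟧_{n, R_f(1 + 4|t| d C_f R_f)²} ≤ 4d`. Uses the DISCHARGED Cor. 7.8
(`Torus.ArmstrongVicol2025_transportShift_grad_holds`) applied to `Y = Dinv − Dinv(0)`
(`Dinv(0)` is a lattice constant). [cite: ArmstrongVicol2025, App. A Prop. 7.10 (proof, p. 73) with Cor. 7.8] -/
theorem dnorm_partialDeriv_dispInv_le (N : ℕ) {Cf Rf : ℝ} (hCf : 0 < Cf) (hRf : 0 < Rf)
    (hf : IsSmoothSpaceTimeOn univ f) (hDinv : IsSmoothSpaceTimeOn univ Dinv) (hD0 : ∀ x, D 0 x = 0)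
    (hODE : ∀ t x, HasDerivAt (fun s => D s x) (f t (x + proj (D t x))) t)
    (hinv₁ : ∀ t x, (x + proj (D t x)) + proj (Dinv t (x + proj (D t x))) = x)
    (hinv₂ : ∀ t y, (y + proj (Dinv t y)) + proj (D t (y + proj (Dinv t y))) = y)
    (hfb : ∀ n, 1 ≤ n → n ≤ N → ∀ t, dnorm n Rf (f t) ≤ Cf) :
    ∀ n, n + 1 ≤ N → ∀ t : ℝ, |t| ≤ 1 / (4 * (Fintype.card d : ℝ) * Cf * Rf) →
      ∀ i j : d, dnorm n (Rf * (1 + 4 * |t| * (Fintype.card d : ℝ) * Cf * Rf) ^ 2)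
          (fun y => partialDeriv j (fun z => Dinv t z i) y) ≤ 4 * (Fintype.card d : ℝ) := by
  intro n hn t ht i j
  -- the shifted inverse displacement `Y = Dinv − Dinv(0)`
  set Y : ℝ → UnitAddTorus d → EuclideanSpace ℝ d := fun s y => Dinv s y - Dinv 0 y with hY
  have hDinv0 : IsSmooth (Dinv 0) := hDinv.isSmooth_slice (mem_univ 0)
  have hYs : IsSmoothSpaceTimeOn univ Y := hDinv.sub (isSmoothSpaceTimeOn_const hDinv0 univ)
  have hY0 : ∀ x, Y 0 x = 0 := fun x => by simp [hY]
  have hDinv1 : ∀ s, IsContDiff 1 (Dinv s) := fun s => (hDinv.isSmooth_slice (mem_univ s)).isContDiff (by simp)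
  have hfdY : ∀ s x, Torus.fderiv (Y s) x = Torus.fderiv (Dinv s) x := by
    intro s x
    rw [hY]
    show Torus.fderiv (fun y => Dinv s y - Dinv 0 y) x = Torus.fderiv (Dinv s) x
    rw [fderiv_sub' (hDinv1 s) (hDinv1 0), fderiv_dispInv_zero hDinv hD0 hinv₁ x, sub_zero]
  have hconvY : ∀ s x, convect (f s) (Y s) x = convect (f s) (Dinv s) x := by
    intro s x
    simp only [convect, hfdY]
  have hODEY : ∀ s x, HasDerivAt (fun τ => Y τ x) ((fun s x => -f s x) s x - convect (f s) (Y s) x) s := by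
    intro s x
    have h := (hasDerivAt_dispInv hDinv hODE hinv₁ hinv₂ s x).sub_const (Dinv 0 x)
    rw [hconvY]
    exact h
  have hgb : ∀ n, 1 ≤ n → n ≤ N → ∀ t, dnorm n Rf ((fun s x => -f s x) t) ≤ Cf := by
    intro n hn1 hnN t
    show dnorm n Rf (fun x => -f t x) ≤ Cf
    rw [dnorm_neg]
    exact hfb n hn1 hnN t
  have h78 := ArmstrongVicol2025_transportShift_grad_holds d N f (fun s x => -f s x) Y Cf Rf Cf Rf hCf hRf
    hCf hRf le_rfl hf hf.neg hYs hY0 hODEY hfb hgb n hn t ht i j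
  -- `∂ⱼ Yᵢ(t) = ∂ⱼ Dinvᵢ(t)` and `4 d C_f R_f/(C_f R_f) = 4 d`
  have hY1 : IsContDiff 1 (Y t) := (hYs.isSmooth_slice (mem_univ t)).isContDiff (by simp)
  have hcomp : (fun y => partialDeriv j (Y t) y i) = fun y => partialDeriv j (fun z => Dinv t z i) y := by
    funext y
    rw [partialDeriv_apply_coord (hDinv1 t), partialDeriv_eq_fderiv_apply hY1,
      partialDeriv_eq_fderiv_apply (hDinv1 t), hfdY]
  have hconst : 4 * (Fintype.card d : ℝ) * Cf * Rf / (Cf * Rf) = 4 * (Fintype.card d : ℝ) := by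
    field_simp
  rw [hcomp, hconst] at h78
  exact h78

end TorusFlow

end Literature.Analysis.ODE

end
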